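import Literature.Analysis.FluidPDE.OnsagerCCFSFlux
import HarnessLib

/-!
# Sharp Onsager rigidity (CCFS 2008, Thm 3.3): the mollified energies converge — discharge of F₄

Sorry-free proof of the named fact `Literature.Analysis.FluidPDE.Torus.tendsto_lintegral_kineticEnergy_vecConv_sub` of
`Literature/Analysis/FluidPDE/OnsagerCCFSFlux` (step "`‖S_Q u(t)‖₂ → ‖u(t)‖₂`" of the proof of
Cheskidov–Constantin–Friedlander–Shvydkoy 2008, Thm 3.3, in mollifier form; Evans, *PDE*,
App. C.4, Thm 7 (iv) integrated in time): for a jointly measurable `u ∈ L²((0,T) × T^d)`,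
`∫₀ᵀ |E(u(t) ⋆ K_ε) - E(u(t))| dt → 0` as `ε → 0⁺`.

* `Torus.eLpNorm_vecConv_kernel_le` — Young: `‖v ⋆ K_ε‖_{L²} ≤ #d ‖v‖_{L²}`;
* `Torus.kineticEnergy_eq_of_memLp` — `E(w) = ½‖w‖²_{L²}`;
* `Torus.tendsto_kineticEnergy_of_tendsto_eLpNorm` — continuity of `E` along `L²` convergence;
* `Torus.tendsto_nhdsGT_zero_of_seq` — right limits at `0` from sequences in `(0, c]`;
* `Torus.tendsto_eLpNorm_vecConv_kernel_sub_self` — `‖v ⋆ K_ε - v‖_{L²} → 0` (componentwise,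
  from the accepted `Torus.tendsto_eLpNorm_convolution_sub_self`);
* `Torus.ae_memLp_two_of_lintegral` — a.e. time slice of an `L²_{t,x}` field is in `L²_x`;
* `Torus.tendsto_lintegral_kineticEnergy_vecConv_sub_holds` — the discharge (dominated
  convergence for `lintegral` along `𝓝[>] 0`, bound `((#d)² + 1) E(u(t))`).

## References

* L. C. Evans, *Partial Differential Equations*, 2nd ed. (AMS 2010), App. C.4, Thm 7 (iv).
* A. Cheskidov, P. Constantin, S. Friedlander, R. Shvydkoy, Nonlinearity 21 (2008) =
  arXiv:0704.0759, proof of Thm 3.3.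
-/

noncomputable section

open MeasureTheory TopologicalSpace Set Function Filter Topology Metric
open scoped ENNReal NNReal Convolution ContDiff InnerProductSpace

namespace Literature.Analysis.FluidPDE

namespace Torus

variable {d : Type*} [Fintype d] [DecidableEq d]


section EnergyConvergence

/-- The Euclidean norm is dominated by the sum of the component norms. [folklore] -/
theorem norm_le_sum_norm_apply (w : EuclideanSpace ℝ d) : ‖w‖ ≤ ∑ i, ‖w i‖ := by
  conv_lhs => rw [← (EuclideanSpace.basisFun d ℝ).sum_repr w]
  refine (norm_sum_le _ _).trans (Finset.sum_le_sum fun i _ => ?_)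
  rw [EuclideanSpace.basisFun_repr, EuclideanSpace.basisFun_apply, norm_smul,
    PiLp.norm_single, norm_one, mul_one]

omit [DecidableEq d] in
/-- Vector mollification is continuous for `v ∈ L¹` and a continuous kernel. [folklore] -/
theorem continuous_vecConv {v : UnitAddTorus d → EuclideanSpace ℝ d} (hv : Integrable v volume)
    {K : UnitAddTorus d → ℝ} (hK : Continuous K) : Continuous (vecConv v K) := by
  have hc : ∀ i, Continuous fun x => ((fun y => v y i) ⋆ K) x := fun i =>
    FunctionSpaces.Torus.continuous_convolution ((EuclideanSpace.proj (𝕜 := ℝ) i).integrable_comp hv :) hK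
  exact (PiLp.continuous_toLp 2 (fun _ : d => ℝ)).comp (continuous_pi hc)

omit [DecidableEq d] in
/-- Continuous vector fields on the torus are in every `L^p`. [folklore] -/
theorem memLp_of_continuous {v : UnitAddTorus d → EuclideanSpace ℝ d} (hv : Continuous v)
    (p : ℝ≥0∞) : MemLp v p volume :=
  hv.memLp_of_hasCompactSupport (HasCompactSupport.of_compactSpace v)

/-- **Young's inequality for vector mollification by the torus kernel, `L²` form**:
`‖v ⋆ K_ε‖_{L²} ≤ (#d) ‖v‖_{L²}` for `v ∈ L²` (componentwise Young with the unit-mass kernel,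
`Torus.eLpNorm_convolution_le`, and `‖w‖ ≤ ∑ᵢ ‖wᵢ‖`, `‖wᵢ‖ ≤ ‖w‖`). [folklore] -/
theorem eLpNorm_vecConv_kernel_le {v : UnitAddTorus d → EuclideanSpace ℝ d}
    (hv : MemLp v 2 volume) {ε : ℝ} (hε : 0 < ε) (hε' : ε ≤ 1 / 4) :
    eLpNorm (vecConv v (FunctionSpaces.Torus.kernel ε)) 2 volume ≤ Fintype.card d * eLpNorm v 2 volume := by
  have hv1 : Integrable v volume := hv.integrable one_le_two
  have hvi : ∀ i, Integrable (fun y => v y i) volume := fun i =>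
    (EuclideanSpace.proj (𝕜 := ℝ) i).integrable_comp hv1
  have hKc : Continuous (FunctionSpaces.Torus.kernel (d := d) ε) := FunctionSpaces.Torus.continuous_kernel hε hε'
  set Fi : d → UnitAddTorus d → ℝ := fun i x => ‖((fun y => v y i) ⋆ FunctionSpaces.Torus.kernel ε) x‖ with hFi
  have hFim : ∀ i, AEStronglyMeasurable (Fi i) volume := fun i =>
    (FunctionSpaces.Torus.continuous_convolution (hvi i) hKc).norm.aestronglyMeasurable
  -- pointwise domination by the sum of the component mollifications
  have h1 : eLpNorm (vecConv v (FunctionSpaces.Torus.kernel ε)) 2 volume ≤ eLpNorm (∑ i, Fi i) 2 volume := by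
    refine eLpNorm_mono_real fun x => ?_
    rw [Finset.sum_apply]
    exact norm_le_sum_norm_apply _
  have h2 : eLpNorm (∑ i, Fi i) 2 volume ≤ ∑ i, eLpNorm (Fi i) 2 volume :=
    eLpNorm_sum_le (fun i _ => hFim i) one_le_two
  have h3 : ∀ i, eLpNorm (Fi i) 2 volume ≤ eLpNorm v 2 volume := fun i => by
    rw [hFi, eLpNorm_norm]
    refine (FunctionSpaces.Torus.eLpNorm_convolution_le (hvi i).aestronglyMeasurable hKc.aestronglyMeasurable
      one_le_two).trans ?_
    rw [FunctionSpaces.Torus.lintegral_enorm_kernel hε hε', one_mul]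
    exact eLpNorm_mono fun x => PiLp.norm_apply_le (v x) i
  calc eLpNorm (vecConv v (FunctionSpaces.Torus.kernel ε)) 2 volume
      ≤ ∑ i, eLpNorm (Fi i) 2 volume := h1.trans h2
    _ ≤ ∑ _i : d, eLpNorm v 2 volume := Finset.sum_le_sum fun i _ => h3 i
    _ = Fintype.card d * eLpNorm v 2 volume := by simp

omit [DecidableEq d] in
/-- **Kinetic energy through the `L²` norm**: `E(w) = ½ ‖w‖²_{L²}` for `w ∈ L²`. [folklore] -/
theorem kineticEnergy_eq_of_memLp {w : UnitAddTorus d → EuclideanSpace ℝ d} (hw : MemLp w 2 volume) :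
    FunctionSpaces.Torus.kineticEnergy w = 2⁻¹ * (eLpNorm w 2 volume).toReal ^ 2 := by
  have h := hw.eLpNorm_eq_integral_rpow_norm two_ne_zero ENNReal.ofNat_ne_top
  have hint : ∫ x, ‖w x‖ ^ (2 : ℝ≥0∞).toReal = ∫ x, ‖w x‖ ^ 2 := by
    refine integral_congr_ae (Eventually.of_forall fun x => ?_)
    simp only [ENNReal.toReal_ofNat, Real.rpow_two]
  rw [hint, ENNReal.toReal_ofNat] at h
  have hI : 0 ≤ ∫ x, ‖w x‖ ^ 2 := integral_nonneg fun _ => sq_nonneg _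
  unfold FunctionSpaces.Torus.kineticEnergy
  rw [h, ENNReal.toReal_ofReal (by positivity), show (2 : ℝ)⁻¹ = 1 / 2 by norm_num,
    ← Real.sqrt_eq_rpow, Real.sq_sqrt hI]

omit [DecidableEq d] in
/-- **The kinetic energy is continuous along `L²` convergence**: if `w i → w₀` in `L²(T^d; ℝ^d)`
along a filter then `E(w i) → E(w₀)`. [folklore] -/
theorem tendsto_kineticEnergy_of_tendsto_eLpNorm {ι : Type*} {l : Filter ι}
    {w : ι → UnitAddTorus d → EuclideanSpace ℝ d} {w₀ : UnitAddTorus d → EuclideanSpace ℝ d}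
    (hw : ∀ᶠ i in l, MemLp (w i) 2 volume) (hw₀ : MemLp w₀ 2 volume)
    (h : Tendsto (fun i => eLpNorm (w i - w₀) 2 volume) l (𝓝 0)) :
    Tendsto (fun i => FunctionSpaces.Torus.kineticEnergy (w i)) l (𝓝 (FunctionSpaces.Torus.kineticEnergy w₀)) := by
  -- the real `L²` norms converge
  set a : ι → ℝ := fun i => (eLpNorm (w i) 2 volume).toReal with ha
  set b : ℝ := (eLpNorm w₀ 2 volume).toReal with hb
  have hd : Tendsto (fun i => (eLpNorm (w i - w₀) 2 volume).toReal) l (𝓝 0) := by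
    have := (ENNReal.tendsto_toReal ENNReal.zero_ne_top).comp h
    rwa [ENNReal.toReal_zero] at this
  have hab : Tendsto a l (𝓝 b) := by
    rw [tendsto_iff_norm_sub_tendsto_zero]
    refine squeeze_zero' (Eventually.of_forall fun i => norm_nonneg _) ?_ hd
    filter_upwards [hw] with i hi
    have hfi : eLpNorm (w i) 2 volume ≠ ⊤ := hi.eLpNorm_ne_top
    have hf0 : eLpNorm w₀ 2 volume ≠ ⊤ := hw₀.eLpNorm_ne_top
    have hdif : eLpNorm (w i - w₀) 2 volume ≠ ⊤ := (hi.sub hw₀).eLpNorm_ne_top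
    have h1 : eLpNorm (w i) 2 volume ≤ eLpNorm (w i - w₀) 2 volume + eLpNorm w₀ 2 volume := by
      have := eLpNorm_add_le (hi.sub hw₀).aestronglyMeasurable hw₀.aestronglyMeasurable
        (p := 2) (μ := volume) one_le_two
      rwa [sub_add_cancel] at this
    have h2 : eLpNorm w₀ 2 volume ≤ eLpNorm (w i - w₀) 2 volume + eLpNorm (w i) 2 volume := by
      have := eLpNorm_add_le (hw₀.sub hi).aestronglyMeasurable hi.aestronglyMeasurable
        (p := 2) (μ := volume) one_le_two
      rwa [sub_add_cancel, eLpNorm_sub_comm] at this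
    have h1' := ENNReal.toReal_mono (ENNReal.add_ne_top.2 ⟨hdif, hf0⟩) h1
    have h2' := ENNReal.toReal_mono (ENNReal.add_ne_top.2 ⟨hdif, hfi⟩) h2
    rw [ENNReal.toReal_add hdif hf0] at h1'
    rw [ENNReal.toReal_add hdif hfi] at h2'
    rw [Real.norm_eq_abs, abs_sub_le_iff]
    constructor <;> linarith
  have hsq : Tendsto (fun i => 2⁻¹ * a i ^ 2) l (𝓝 (2⁻¹ * b ^ 2)) := (hab.pow 2).const_mul 2⁻¹
  rw [kineticEnergy_eq_of_memLp hw₀]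
  refine hsq.congr' ?_
  filter_upwards [hw] with i hi
  rw [kineticEnergy_eq_of_memLp hi]

/-- **Right limits at `0` from sequences in `(0, c]`.** To prove `f(ε) → l'` as `ε → 0⁺` it
suffices to test sequences `yₙ → 0` with `0 < yₙ ≤ c` for all `n` (given `c > 0`): a general
sequence tending to `0` from the right enters `(0, c]` after finitely many terms, which may be
discarded. [folklore] -/
theorem tendsto_nhdsGT_zero_of_seq {β : Type*} {l' : Filter β} {f : ℝ → β} {c : ℝ} (hc : 0 < c)
    (h : ∀ y : ℕ → ℝ, (∀ n, 0 < y n ∧ y n ≤ c) → Tendsto y atTop (𝓝 0) →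
      Tendsto (f ∘ y) atTop l') :
    Tendsto f (𝓝[>] 0) l' := by
  rw [tendsto_iff_seq_tendsto]
  intro x hx
  have hx0 : Tendsto x atTop (𝓝 0) := tendsto_nhds_of_tendsto_nhdsWithin hx
  have hev : ∀ᶠ n in atTop, 0 < x n ∧ x n ≤ c := by
    have h1 : ∀ᶠ n in atTop, x n ∈ Ioi (0 : ℝ) := hx.eventually (self_mem_nhdsWithin)
    have h2 : ∀ᶠ n in atTop, x n < c := hx0.eventually (Iio_mem_nhds hc)
    filter_upwards [h1, h2] with n hn1 hn2 using ⟨hn1, hn2.le⟩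
  obtain ⟨N, hN⟩ := eventually_atTop.1 hev
  have hy := h (fun n => x (n + N)) (fun n => hN _ (Nat.le_add_left _ _))
    ((tendsto_add_atTop_iff_nat N).2 hx0)
  have : (f ∘ fun n => x (n + N)) = fun n => (f ∘ x) (n + N) := rfl
  rw [this, tendsto_add_atTop_iff_nat N] at hy
  exact hy

omit [DecidableEq d] in
/-- **`L²` convergence of real mollification along `ε → 0⁺`** (filter form of
`Torus.tendsto_eLpNorm_convolution_sub_self` for the kernels `Torus.kernel ε`). [folklore] -/
theorem tendsto_eLpNorm_convolution_kernel_sub_self {θ : UnitAddTorus d → ℝ} (hθ : MemLp θ 2 volume) :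
    Tendsto (fun ε => eLpNorm (θ ⋆ FunctionSpaces.Torus.kernel ε - θ) 2 volume) (𝓝[>] 0) (𝓝 0) := by
  refine tendsto_nhdsGT_zero_of_seq (c := 1 / 4) (by norm_num) fun y hy hy0 => ?_
  exact FunctionSpaces.Torus.tendsto_eLpNorm_convolution_sub_self hθ (k := fun n => FunctionSpaces.Torus.kernel (y n)) (δ := y)
    (fun n z => FunctionSpaces.Torus.kernel_nonneg (hy n).1.le z) (fun n => FunctionSpaces.Torus.integral_kernel (hy n).1 (hy n).2)
    (fun n => FunctionSpaces.Torus.support_kernel_subset (hy n).1) (fun n => FunctionSpaces.Torus.continuous_kernel (hy n).1 (hy n).2) hy0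

/-- **`L²` convergence of vector mollification along `ε → 0⁺`**: for `v ∈ L²(T^d; ℝ^d)`,
`‖v ⋆ K_ε - v‖_{L²} → 0` (componentwise, `‖w‖ ≤ ∑ᵢ ‖wᵢ‖`). [folklore] -/
theorem tendsto_eLpNorm_vecConv_kernel_sub_self {v : UnitAddTorus d → EuclideanSpace ℝ d}
    (hv : MemLp v 2 volume) :
    Tendsto (fun ε => eLpNorm (vecConv v (FunctionSpaces.Torus.kernel ε) - v) 2 volume) (𝓝[>] 0) (𝓝 0) := by
  have hvi2 : ∀ i, MemLp (fun y => v y i) 2 volume := fun i =>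
    (EuclideanSpace.proj (𝕜 := ℝ) i).comp_memLp' hv
  set Fi : ℝ → d → UnitAddTorus d → ℝ := fun ε i x =>
    ‖((fun y => v y i) ⋆ FunctionSpaces.Torus.kernel ε) x - v x i‖ with hFi
  have hsum : Tendsto (fun ε => ∑ i, eLpNorm (Fi ε i) 2 volume) (𝓝[>] 0) (𝓝 0) := by
    have h0 : Tendsto (fun ε => ∑ i, eLpNorm (Fi ε i) 2 volume) (𝓝[>] 0)
        (𝓝 (∑ _i : d, (0 : ℝ≥0∞))) := by
      refine tendsto_finsetSum _ fun i _ => ?_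
      have h := tendsto_eLpNorm_convolution_kernel_sub_self (hvi2 i)
      refine h.congr fun ε => ?_
      rw [hFi, eLpNorm_norm]
      rfl
    simpa using h0
  refine tendsto_of_tendsto_of_tendsto_of_le_of_le' tendsto_const_nhds hsum
    (Eventually.of_forall fun ε => bot_le) ?_
  filter_upwards [Ioc_mem_nhdsGT (show (0 : ℝ) < 1 / 4 by norm_num)] with ε hε
  have hle : eLpNorm (vecConv v (FunctionSpaces.Torus.kernel ε) - v) 2 volume ≤ eLpNorm (∑ i, Fi ε i) 2 volume := by
    refine eLpNorm_mono_real fun x => ?_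
    rw [Finset.sum_apply]
    refine (norm_le_sum_norm_apply _).trans (le_of_eq (Finset.sum_congr rfl fun i _ => ?_))
    simp [hFi, vecConv]
  refine hle.trans (eLpNorm_sum_le (fun i _ => ?_) one_le_two)
  exact ((FunctionSpaces.Torus.continuous_convolution ((hvi2 i).integrable one_le_two)
    (FunctionSpaces.Torus.continuous_kernel hε.1 hε.2)).aestronglyMeasurable.sub (hvi2 i).aestronglyMeasurable).norm

omit [DecidableEq d] in
/-- **Almost every time slice of an `L²_{t,x}` field is in `L²_x`.** [folklore] -/
theorem ae_memLp_two_of_lintegral {S : Set ℝ} {u : ℝ → UnitAddTorus d → EuclideanSpace ℝ d}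
    (hm : AEStronglyMeasurable (uncurry u) ((volume.restrict S).prod volume))
    (h2 : ∫⁻ t in S, ∫⁻ x, ‖u t x‖ₑ ^ 2 < ⊤) :
    ∀ᵐ t ∂(volume.restrict S), MemLp (u t) 2 volume := by
  have hsec : ∀ᵐ t ∂(volume.restrict S), AEStronglyMeasurable (u t) volume := hm.prodMk_left
  have hmeas : AEMeasurable (fun t => ∫⁻ x, ‖u t x‖ₑ ^ 2) (volume.restrict S) :=
    ((hm.enorm.pow_const 2)).lintegral_prod_right'
  have hfin : ∀ᵐ t ∂(volume.restrict S), ∫⁻ x, ‖u t x‖ₑ ^ 2 < ⊤ := ae_lt_top' hmeas h2.ne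
  filter_upwards [hsec, hfin] with t ht htfin
  refine ⟨ht, ?_⟩
  rw [eLpNorm_eq_lintegral_rpow_enorm_toReal two_ne_zero ENNReal.ofNat_ne_top]
  refine ENNReal.rpow_lt_top_of_nonneg (by norm_num) (ne_of_lt ?_)
  have h2r : ((2 : ℝ≥0∞)).toReal = ((2 : ℕ) : ℝ) := by norm_num
  simp_rw [h2r, ENNReal.rpow_natCast]
  exact htfin

omit [DecidableEq d] in
/-- `‖x - y‖ₑ ≤ ENNReal.ofReal (x + y)` for nonnegative reals. [folklore] -/
theorem enorm_sub_le_ofReal_add {x y : ℝ} (hx : 0 ≤ x) (hy : 0 ≤ y) :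
    ‖x - y‖ₑ ≤ ENNReal.ofReal (x + y) := by
  rw [Real.enorm_eq_ofReal_abs]
  refine ENNReal.ofReal_le_ofReal ?_
  rw [abs_sub_le_iff]
  constructor <;> linarith

/-- **Discharge of `tendsto_lintegral_kineticEnergy_vecConv_sub`** (Evans, App. C.4, Thm 7 (iv),
integrated in time): for a jointly measurable `u ∈ L²((0,T) × T^d)`,
`∫₀ᵀ |E(u(t) ⋆ K_ε) - E(u(t))| dt → 0` as `ε → 0⁺`. Proof: dominated convergence for the lower
Lebesgue integral along `𝓝[>] 0` (Mathlib's `tendsto_lintegral_filter_of_dominated_convergence'`):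
at a.e. time `u(t) ∈ L²` (`ae_memLp_two_of_lintegral`), so `E(u(t) ⋆ K_ε) → E(u(t))` by the
`L²` convergence of mollification (`tendsto_eLpNorm_vecConv_kernel_sub_self`,
`tendsto_kineticEnergy_of_tendsto_eLpNorm`), with the domination
`|E(u(t) ⋆ K_ε) - E(u(t))| ≤ ((#d)² + 1) E(u(t)) ∈ L¹(0,T)` from Young's inequality
(`eLpNorm_vecConv_kernel_le`). [cite: Evans2010, App. C.4 Thm 7 (iv)] -/
theorem tendsto_lintegral_kineticEnergy_vecConv_sub_holds :
    tendsto_lintegral_kineticEnergy_vecConv_sub (d := d) := by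
  intro T u hm hu2
  have hm' : AEStronglyMeasurable (uncurry u) ((volume.restrict (Ioo 0 T)).prod volume) :=
    aestronglyMeasurable_uncurry_restrict_prod_of_stLift hm
  have hslice : ∀ᵐ t ∂(volume.restrict (Ioo 0 T)), MemLp (u t) 2 volume :=
    ae_memLp_two_of_lintegral hm' hu2
  have he : IntegrableOn (fun t => FunctionSpaces.Torus.kineticEnergy (u t)) (Ioo 0 T) :=
    integrableOn_kineticEnergy hm' hu2
  have hsmall : ∀ᶠ ε in 𝓝[>] (0 : ℝ), 0 < ε ∧ ε ≤ 1 / 4 := by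
    filter_upwards [Ioc_mem_nhdsGT (show (0 : ℝ) < 1 / 4 by norm_num)] with ε hε
    exact ⟨hε.1, hε.2⟩
  set c : ℝ := (Fintype.card d : ℝ) ^ 2 + 1 with hc
  have hc0 : 0 ≤ c := by positivity
  set bound : ℝ → ℝ≥0∞ := fun t => ENNReal.ofReal c * ‖FunctionSpaces.Torus.kineticEnergy (u t)‖ₑ with hbound
  have h := tendsto_lintegral_filter_of_dominated_convergence' (μ := volume.restrict (Ioo 0 T))
    (l := 𝓝[>] (0 : ℝ))
    (F := fun ε t => ‖FunctionSpaces.Torus.kineticEnergy (vecConv (u t) (FunctionSpaces.Torus.kernel ε)) - FunctionSpaces.Torus.kineticEnergy (u t)‖ₑ)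
    (f := fun _ => 0) bound ?_ ?_ ?_ ?_
  · simpa only [lintegral_zero] using h
  · -- measurability at admissible scales
    filter_upwards [hsmall] with ε hε
    exact ((aestronglyMeasurable_kineticEnergy_vecConv hm' (FunctionSpaces.Torus.continuous_kernel hε.1 hε.2)).sub
      he.aestronglyMeasurable).enorm
  · -- domination
    filter_upwards [hsmall] with ε hε
    filter_upwards [hslice] with t ht
    have hEc : MemLp (vecConv (u t) (FunctionSpaces.Torus.kernel ε)) 2 volume :=
      memLp_of_continuous (continuous_vecConv (ht.integrable one_le_two)
        (FunctionSpaces.Torus.continuous_kernel hε.1 hε.2)) 2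
    have hY := eLpNorm_vecConv_kernel_le ht hε.1 hε.2
    have hfin : eLpNorm (u t) 2 volume ≠ ⊤ := ht.eLpNorm_ne_top
    have hY' : (eLpNorm (vecConv (u t) (FunctionSpaces.Torus.kernel ε)) 2 volume).toReal ≤
        Fintype.card d * (eLpNorm (u t) 2 volume).toReal := by
      have := ENNReal.toReal_mono (ENNReal.mul_ne_top (by simp) hfin) hY
      rwa [ENNReal.toReal_mul, ENNReal.toReal_natCast] at this
    have hE0 : 0 ≤ FunctionSpaces.Torus.kineticEnergy (u t) := FunctionSpaces.Torus.kineticEnergy_nonneg _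
    have hEε0 : 0 ≤ FunctionSpaces.Torus.kineticEnergy (vecConv (u t) (FunctionSpaces.Torus.kernel ε)) := FunctionSpaces.Torus.kineticEnergy_nonneg _
    have hEε : FunctionSpaces.Torus.kineticEnergy (vecConv (u t) (FunctionSpaces.Torus.kernel ε)) ≤
        (Fintype.card d : ℝ) ^ 2 * FunctionSpaces.Torus.kineticEnergy (u t) := by
      rw [kineticEnergy_eq_of_memLp hEc, kineticEnergy_eq_of_memLp ht]
      have h0 : 0 ≤ (eLpNorm (vecConv (u t) (FunctionSpaces.Torus.kernel ε)) 2 volume).toReal := ENNReal.toReal_nonneg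
      nlinarith [hY', h0]
    show ‖FunctionSpaces.Torus.kineticEnergy (vecConv (u t) (FunctionSpaces.Torus.kernel ε)) - FunctionSpaces.Torus.kineticEnergy (u t)‖ₑ ≤
      ENNReal.ofReal c * ‖FunctionSpaces.Torus.kineticEnergy (u t)‖ₑ
    rw [Real.enorm_eq_ofReal hE0, ← ENNReal.ofReal_mul hc0]
    refine (enorm_sub_le_ofReal_add hEε0 hE0).trans (ENNReal.ofReal_le_ofReal ?_)
    rw [hc]
    nlinarith
  · -- the bound is integrable
    rw [hbound, lintegral_const_mul' _ _ ENNReal.ofReal_ne_top]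
    exact ENNReal.mul_ne_top ENNReal.ofReal_ne_top he.2.ne
  · -- pointwise convergence at a.e. time
    filter_upwards [hslice] with t ht
    have hEc : ∀ᶠ ε in 𝓝[>] (0 : ℝ), MemLp (vecConv (u t) (FunctionSpaces.Torus.kernel ε)) 2 volume := by
      filter_upwards [hsmall] with ε hε
      exact memLp_of_continuous (continuous_vecConv (ht.integrable one_le_two)
        (FunctionSpaces.Torus.continuous_kernel hε.1 hε.2)) 2
    have hlim := tendsto_kineticEnergy_of_tendsto_eLpNorm hEc ht
      (tendsto_eLpNorm_vecConv_kernel_sub_self ht)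
    rw [tendsto_iff_norm_sub_tendsto_zero] at hlim
    have := ENNReal.tendsto_ofReal hlim
    rw [ENNReal.ofReal_zero] at this
    refine this.congr fun ε => ?_
    rw [ofReal_norm]

end EnergyConvergence

end Torus

end Literature.Analysis.FluidPDE
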